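import Mathlib
import HarnessLib
import HarnessLib.Audit
import Summits.Langlands.Statement
import Summits.Langlands.Langlands.Theses.DescentTypeTrichotomy
import Summits.Langlands.Langlands.Theses.FaltingsSerreTransfer
import Summits.Langlands.Langlands.Theorems.DescentTypeTrichotomyInsolvableTypeAutomorphyOfSplit
import Literature.NumberTheory.Automorphic.AutomorphicRepsGLSatakeFlathProofs

/-!
# FaltingsSerreTransfer — TWIN of the lens-3 node (decomp-langlands, lens-3 gen 19) on the primitive dark residual PRIM

(Twin = kit node HOME/nodes/lens-3-g19-FaltingsSerreTransfer.lean minus the root-necessity certificates `prim_of_langlands`,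
`cert_of_langlands`, `avc_of_langlands`, `pieces_of_langlands` — crit-1 row 285 d1: no modulo-cycle through the summit in the
gate closure display; they stay in the kit.)

TARGET `PRIM` = `Summit.Langlands.Langlands.Theses.DescentTypeTrichotomy.PrimitiveTypeAutomorphy` (stmt-Langlands-29575,
crux r202 OPEN, DECLARED RESIDUAL, layer-2 child of GEN 29559 on route-Langlands-DescentTypeTrichotomy; host header: «PRIM is
not decomposed at all (IDEA-NEEDED)»): for every number field K, n ≥ 2, ℓ, ι and every irreducible pinned-geometric
Lie-irreducible ρ : Γ_K → GL_n(ℚ̄_ℓ) that is NOT potentially of TR/CM type, there is an L-algebraic cuspidal π on GL_n/K whose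
Satake parameters match ρ(Frob_v) at almost all v.  Since every subfield of a CM field is TR or CM, such K admit NO TR/CM
overfield: over them BOTH directions of reciprocity are dark ((A): no Shimura variety, l₀ = r₂ > 0; (B): nothing to lift from).

THE ONE EQUIV (lens-3 translation — the language of HECKE–FROBENIUS CERTIFICATES).  Call a finite set T of finite places of K
(S, B)-COVERING if the arithmetic Frobenii at places of T meet, up to conjugacy, every element of the image of every continuous
φ : Γ_K → H into a finite group of order ≤ B unramified outside S (inline: `Ideal.inertia`, `IsArithFrobAt`, `IsConj`).  Say
(π, ρ) is CERTIFIED if for every depth B and every finite S′ there is a finite (S′, B)-covering T disjoint from S′ on which the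
Satake parameters of π match ρ(Frob_v) (`SatakeFrobCompatibleAt` at every v ∈ T).  DICTIONARY (kernel `aeCompatible_iff_certified`):
    GIVEN an ℓ-adic avatar ρ_π of π (any framed ρ_π Satake–Frobenius compatible with π at almost all v):
        «(π, ρ) Satake–Frobenius compatible at almost all v»   ⟺   «(π, ρ) certified»
MODULO two PRINT facts typed below: the Faltings–Serre criterion in class-covering form (FS) for ⟸ and the Chebotarev–Hermite
existence of covering sets avoiding any finite set (CHEB) for ⟹.  (⟸: FS applied to (ρ, ρ_π) on a certificate avoiding S_FS ∪ the
avatar's exceptional set; the common Frobenius polynomial at v ∈ T is `arithFrobPolyOfSatake` of THE Satake parameter —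
uniqueness `AutomorphicRepData.hasSatakeParamAt_unique_holds`, PROVED — so charpoly ρ = charpoly ρ_π on Γ_K and ρ inherits the
avatar's a.e. compatibility.)

THE SPLIT BENEATH (not a population dial, not a grading: a factorisation of the (B)-dark box THROUGH the (A)-dark box):
    PRIM  ⟸  CERT ∧ AVC ∧ FS            (kernel `closes`, 0 sorry; every binder used)
* CERT `CertifiedMatching`   (crux 2): every PRIM-box ρ (box VERBATIM) admits an L-algebraic cuspidal π of GL_n/K CERTIFIED against ρ.
  WEAKER: PRIM ⟹ CERT (kernel `cert_of_prim`, mod CHEB) and Langlands ⟹ CERT (kit-only kernel `cert_of_langlands`); NOT known to give PRIM — over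
  these K no cuspidal π has a Galois representation.  No deformation ring, no Shimura variety, no trace formula comparison occurs
  in it: per (instance, DEPTH B) one certificate is a FINITE computation (Hecke eigenvalues of one cohomology class on a covering
  set) — CERT(ρ) itself still quantifies ∀ B ∀ S′, so instances are INSTRUMENT-only, never computation-closable (crit-1 row 298 e1) — the statement that
  the Gunnells–Yasaki / Donnelly–Gunnells–Klages-Mundt–Yasaki tables verify numerically over the cubic field of
  discriminant −23, arXiv:1201.4132 / arXiv:1409.7911 (first box: E′ with v_𝔭(j) < 0 at one 𝔭 | 59 over ℚ(α), α³ − α − 1 = 0).  INSTRUMENTABLE · IDEA-NEEDED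
  as a ∀-statement.
* AVC `CertificateAvatars`   (crux 3, DECLARED RESIDUAL): every L-algebraic cuspidal π of GL_n/K (n ≥ 2) that is certified against
  SOME PRIM-box ρ has an ℓ-adic avatar (a framed ρ_π Satake–Frobenius compatible a.e.).  WEAKER: a SUB-BOX of W⁺ 17415 =
  host `SatakeAvatarExistence` (kernel `avc_of_satakeAvatarExistence`) and of E 23598; Langlands ⟹ AVC (kit-only kernel `avc_of_langlands`).  This
  is exactly the (A)-dark core (census: «(B)-twin of G 29147») made LOAD-BEARING BY KERNEL.  BARRIER `ShimuraVarietyRealizationBarrier`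
  head-on (no TR/CM overfield ⇒ no Shimura variety, no Scholze/HLTT boundary construction over any extension).
* FS `FaltingsSerreCriterion` (support 9, PRINT): for any two framed continuous ρ₁, ρ₂ : Γ_K → GL_n(ℚ̄_ℓ) there are B, S (finite)
  such that equality of Frobenius characteristic polynomials on ANY (S, B)-covering T forces charpoly ρ₁ = charpoly ρ₂ on Γ_K
  (Faltings 1983; Serre 1984–85; Livné 1987; Grenié 2007 — proof: R = 𝒪_E⟨(ρ₁,ρ₂)(Γ)⟩ ⊂ M_n(𝒪_E)², L = tr₁ − tr₂ is invariant under
  unit conjugation, H = (R ⊗ k)^×, |H| < |k|^{2n²}; conjugates of the T-Frobenius images span R ⊗ k, Nakayama ⇒ L = 0 on R).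
EXACTNESS modulo the residual: `target_iff_cert (hFS hCheb hAVC) : PRIM ↔ CERT`.  ROOT chain: `host_of_cells` feeds `closes` into the
PROVED split glue `InsolvableTypeAutomorphy_of_split_proof` and the host's `DescentTypeTrichotomy.closes`.
CHEB `ChebotarevCoveringSets` (node-only def, PRINT: Chebotarev 1926 + Hermite–Minkowski) is a hypothesis of the necessity kernels
only; it is not a route item (the deciding direction does not use it).


CENSUS TWIN (census-1 g26): landing file `N.twin.lean` (REV r1 fd0be9fccff4) of the lens-3-g19 node RETARGETED after birth (84th cell route,
route-Langlands-FaltingsSerreTransfer rev 0 @d262bc43235b, crit-1 CLEARED row 298): the three cells and the Assembly are NOT re-declared — the born decls are used BY NAME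
(bodies checked byte-identical: 2787 / 3007 / 1097 ch); `closes` → `prim_of_cells`, `closes_host` → `host_of_cells`, `assembly_proof` dropped (the Assembly item is closed by
`Theorems/FaltingsSerreTransferAssembly.lean`).  Filed `--supports stmt-Langlands-29575 --as helper` per the lens RUNME STEP T.
-/

set_option linter.dupNamespace false

namespace Summit.Langlands.Langlands.Theorems.FSTransfer

/-! The cells `CertifiedMatching` (stmt-Langlands-28079), `CertificateAvatars` (28080), `FaltingsSerreCriterion` (28081) and the `Assembly` (28082) are the
BORN ROUTE's decls (`Summits.Langlands.Langlands.Theses.FaltingsSerreTransfer`, 84th cell route), used BY NAME; only the node-local print predicate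
`ChebotarevCoveringSets` (CHEB, the ⟹ direction's named input, not an item) is declared here. -/
open Summit.Langlands.Langlands.Theses.FaltingsSerreTransfer (CertifiedMatching CertificateAvatars FaltingsSerreCriterion)

open Summit.Langlands.Langlands.Theses.DescentTypeTrichotomy (PrimitiveTypeAutomorphy InsolvableBaseChangeAutomorphy
  InsolvableTypeAutomorphy SatakeAvatarExistence RankOneAutomorphy SolvableTypeAutomorphy ArtinTypeAutomorphy
  CliffordTateStructure StructuredTransport PadicMemberCompatibility CompatibilityAwayFromLR CanonicalReciprocityData)

/-- CHEB — COVERING SETS EXIST AND AVOID ANY FINITE SET (node-only def · PRINT: Chebotarev's density theorem + Hermite–Minkowski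
finiteness of the extensions of K of degree ≤ B unramified outside S′; NOT a route item — used only by the necessity kernels).  For every
finite S′, every B and every finite S″ there is a finite (S′, B)-covering T disjoint from S″. -/
def ChebotarevCoveringSets : Prop :=
  ∀ (K : Type) [Field K] [NumberField K] (S' : Set (IsDedekindDomain.HeightOneSpectrum (NumberField.RingOfIntegers K))), S'.Finite → ∀ (B : ℕ) (S'' : Set (IsDedekindDomain.HeightOneSpectrum (NumberField.RingOfIntegers K))), S''.Finite → ∃ T : Set (IsDedekindDomain.HeightOneSpectrum (NumberField.RingOfIntegers K)), T.Finite ∧ Disjoint T S'' ∧ (∀ (H : Type) [Group H] [Finite H], Nat.card H ≤ B → ∀ φ : Field.absoluteGaloisGroup K →* H, IsOpen (φ.ker : Set (Field.absoluteGaloisGroup K)) → (∀ v : IsDedekindDomain.HeightOneSpectrum (NumberField.RingOfIntegers K), v ∉ S' → ∀ 𝔓 ∈ v.primesAbove, ∀ σ ∈ 𝔓.inertia (Field.absoluteGaloisGroup K), φ σ = 1) → ∀ g : Field.absoluteGaloisGroup K, ∃ v ∈ T, ∃ 𝔓 ∈ v.primesAbove, ∃ σ : Field.absoluteGaloisGroup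 K, IsArithFrobAt (NumberField.RingOfIntegers K) σ 𝔓 ∧ IsConj (φ σ) (φ g))

open scoped NumberField MatrixGroups Matrix Classical
open IsDedekindDomain Filter Literature.NumberTheory.Automorphic Literature.NumberTheory.GaloisRepresentations

/-! ## The dictionary (the ONE EQUIV of the node) -/

/-- ⟸ of the dictionary: a certificate of every depth plus ANY ℓ-adic avatar of π gives Satake–Frobenius compatibility of (π, ρ)
at almost all places (Faltings–Serre on (ρ, ρ_π); the certificate is taken at the FS depth, avoiding the FS set S and the
avatar's finite exceptional set; Satake parameters are unique, `hasSatakeParamAt_unique_holds`). -/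
theorem aeCompatible_of_certified (hFS : FaltingsSerreCriterion)
    {K : Type} [Field K] [NumberField K] {n : ℕ} {hcpt : Literature.NumberTheory.Automorphic.isCompact_glFiniteIntegralLevel n K}
    {ℓ : ℕ} [Fact ℓ.Prime] (ι : PadicAlgCl ℓ ≃+* ℂ) (π : Literature.NumberTheory.Automorphic.AutomorphicRepData (Literature.NumberTheory.Automorphic.AutomorphyDatum.gl n K hcpt))
    (ρ : FramedGaloisRep K (PadicAlgCl ℓ) n)
    (hunr : ∀ᶠ v : HeightOneSpectrum (𝓞 K) in cofinite, ρ.IsUnramifiedAt v)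
    (havatar : ∃ ρπ : FramedGaloisRep K (PadicAlgCl ℓ) n,
      ∀ᶠ v : HeightOneSpectrum (𝓞 K) in cofinite, SatakeFrobCompatibleAt ι π ρπ v)
    (hcert : (∀ (B : ℕ) (S' : Set (IsDedekindDomain.HeightOneSpectrum (NumberField.RingOfIntegers K))), S'.Finite → ∃ T : Set (IsDedekindDomain.HeightOneSpectrum (NumberField.RingOfIntegers K)), T.Finite ∧ Disjoint T S' ∧ (∀ (H : Type) [Group H] [Finite H], Nat.card H ≤ B → ∀ φ : Field.absoluteGaloisGroup K →* H, IsOpen (φ.ker : Set (Field.absoluteGaloisGroup K)) → (∀ v : IsDedekindDomain.HeightOneSpectrum (NumberField.RingOfIntegers K), v ∉ S' → ∀ 𝔓 ∈ v.primesAbove, ∀ σ ∈ 𝔓.inertia (Field.absoluteGaloisGroup K), φ σ = 1) → ∀ g : Field.absoluteGaloisGroup K, ∃ v ∈ T, ∃ 𝔓 ∈ v.primesAbove, ∃ σ : Field.absoluteGaloisGroup K, IsArithFrobAt (NumberField.RingOfIntegers K) σ 𝔓 ∧ IsConj (φ σ) (φ g)) ∧ ∀ v ∈ T, SatakeFrobCompatibleAt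 ι π ρ v)) :
    ∀ᶠ v : HeightOneSpectrum (𝓞 K) in cofinite, SatakeFrobCompatibleAt ι π ρ v := by
  obtain ⟨ρπ, hρπ⟩ := havatar
  obtain ⟨B, S, hSfin, hFS'⟩ := hFS K ℓ n ρ ρπ
  have hE : {v : HeightOneSpectrum (𝓞 K) | ¬ SatakeFrobCompatibleAt ι π ρπ v}.Finite :=
    Filter.eventually_cofinite.mp hρπ
  obtain ⟨T, -, hTdisj, hTcov, hTmatch⟩ :=
    hcert B (S ∪ {v : HeightOneSpectrum (𝓞 K) | ¬ SatakeFrobCompatibleAt ι π ρπ v}) (hSfin.union hE)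
  have hTcovS : (∀ (H : Type) [Group H] [Finite H], Nat.card H ≤ B → ∀ φ : Field.absoluteGaloisGroup K →* H, IsOpen (φ.ker : Set (Field.absoluteGaloisGroup K)) → (∀ v : IsDedekindDomain.HeightOneSpectrum (NumberField.RingOfIntegers K), v ∉ S → ∀ 𝔓 ∈ v.primesAbove, ∀ σ ∈ 𝔓.inertia (Field.absoluteGaloisGroup K), φ σ = 1) → ∀ g : Field.absoluteGaloisGroup K, ∃ v ∈ T, ∃ 𝔓 ∈ v.primesAbove, ∃ σ : Field.absoluteGaloisGroup K, IsArithFrobAt (NumberField.RingOfIntegers K) σ 𝔓 ∧ IsConj (φ σ) (φ g)) := by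
    intro H _ _ hH φ hφ hunrφ g
    exact hTcov H hH φ hφ (fun v hv => hunrφ v (fun hS => hv (Set.mem_union_left _ hS))) g
  have hcommon : ∀ v ∈ T, ∃ P : Polynomial (PadicAlgCl ℓ), ρ.HasFrobCharpolyAt v P ∧ ρπ.HasFrobCharpolyAt v P := by
    intro v hvT
    obtain ⟨α, hπα, -, hρP⟩ := hTmatch v hvT
    have hgood : SatakeFrobCompatibleAt ι π ρπ v := by
      by_contra hbad
      exact (Set.disjoint_left.mp hTdisj hvT) (Set.mem_union_right _ hbad)
    obtain ⟨α', hπα', -, hρπP⟩ := hgood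
    obtain rfl : α = α' := AutomorphicRepData.hasSatakeParamAt_unique_holds π hπα hπα'
    exact ⟨_, hρP, hρπP⟩
  have hchar : ∀ σ : Field.absoluteGaloisGroup K, FramedRep.charpoly ρ σ = FramedRep.charpoly ρπ σ :=
    hFS' T hTcovS hcommon
  filter_upwards [hρπ, hunr] with v hv hvunr
  obtain ⟨α, hπα, -, hP⟩ := hv
  refine ⟨α, hπα, hvunr, ?_⟩
  intro 𝔓 h𝔓 σ hσ
  rw [hchar σ]
  exact hP 𝔓 h𝔓 σ hσ

/-- ⟹ of the dictionary: Satake–Frobenius compatibility at almost all places gives certificates of every depth avoiding any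
finite set (choose the covering set inside the good cofinite set: Chebotarev–Hermite). -/
theorem certified_of_aeCompatible (hCheb : ChebotarevCoveringSets)
    {K : Type} [Field K] [NumberField K] {n : ℕ} {hcpt : Literature.NumberTheory.Automorphic.isCompact_glFiniteIntegralLevel n K}
    {ℓ : ℕ} [Fact ℓ.Prime] (ι : PadicAlgCl ℓ ≃+* ℂ) (π : Literature.NumberTheory.Automorphic.AutomorphicRepData (Literature.NumberTheory.Automorphic.AutomorphyDatum.gl n K hcpt))
    (ρ : FramedGaloisRep K (PadicAlgCl ℓ) n)
    (hae : ∀ᶠ v : HeightOneSpectrum (𝓞 K) in cofinite, SatakeFrobCompatibleAt ι π ρ v) :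
    (∀ (B : ℕ) (S' : Set (IsDedekindDomain.HeightOneSpectrum (NumberField.RingOfIntegers K))), S'.Finite → ∃ T : Set (IsDedekindDomain.HeightOneSpectrum (NumberField.RingOfIntegers K)), T.Finite ∧ Disjoint T S' ∧ (∀ (H : Type) [Group H] [Finite H], Nat.card H ≤ B → ∀ φ : Field.absoluteGaloisGroup K →* H, IsOpen (φ.ker : Set (Field.absoluteGaloisGroup K)) → (∀ v : IsDedekindDomain.HeightOneSpectrum (NumberField.RingOfIntegers K), v ∉ S' → ∀ 𝔓 ∈ v.primesAbove, ∀ σ ∈ 𝔓.inertia (Field.absoluteGaloisGroup K), φ σ = 1) → ∀ g : Field.absoluteGaloisGroup K, ∃ v ∈ T, ∃ 𝔓 ∈ v.primesAbove, ∃ σ : Field.absoluteGaloisGroup K, IsArithFrobAt (NumberField.RingOfIntegers K) σ 𝔓 ∧ IsConj (φ σ) (φ g)) ∧ ∀ v ∈ T, SatakeFrobCompatibleAt ι π ρ v) := by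
  intro B S' hS'
  have hE : {v : HeightOneSpectrum (𝓞 K) | ¬ SatakeFrobCompatibleAt ι π ρ v}.Finite :=
    Filter.eventually_cofinite.mp hae
  obtain ⟨T, hTfin, hTdisj, hTcov⟩ :=
    hCheb K S' hS' B (S' ∪ {v : HeightOneSpectrum (𝓞 K) | ¬ SatakeFrobCompatibleAt ι π ρ v}) (hS'.union hE)
  refine ⟨T, hTfin, Disjoint.mono_right Set.subset_union_left hTdisj, hTcov, fun v hvT => ?_⟩
  by_contra hbad
  exact (Set.disjoint_left.mp hTdisj hvT) (Set.mem_union_right _ hbad)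

/-- THE ONE EQUIV of the node (lens-3), certified in kernel MODULO the two print facts FS, CHEB and GIVEN an ℓ-adic avatar of π:
a.e. Satake–Frobenius compatibility of (π, ρ) ⟺ (π, ρ) certified at every depth. -/
theorem aeCompatible_iff_certified (hFS : FaltingsSerreCriterion) (hCheb : ChebotarevCoveringSets)
    {K : Type} [Field K] [NumberField K] {n : ℕ} {hcpt : Literature.NumberTheory.Automorphic.isCompact_glFiniteIntegralLevel n K}
    {ℓ : ℕ} [Fact ℓ.Prime] (ι : PadicAlgCl ℓ ≃+* ℂ) (π : Literature.NumberTheory.Automorphic.AutomorphicRepData (Literature.NumberTheory.Automorphic.AutomorphyDatum.gl n K hcpt))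
    (ρ : FramedGaloisRep K (PadicAlgCl ℓ) n)
    (hunr : ∀ᶠ v : HeightOneSpectrum (𝓞 K) in cofinite, ρ.IsUnramifiedAt v)
    (havatar : ∃ ρπ : FramedGaloisRep K (PadicAlgCl ℓ) n,
      ∀ᶠ v : HeightOneSpectrum (𝓞 K) in cofinite, SatakeFrobCompatibleAt ι π ρπ v) :
    (∀ᶠ v : HeightOneSpectrum (𝓞 K) in cofinite, SatakeFrobCompatibleAt ι π ρ v) ↔
    (∀ (B : ℕ) (S' : Set (IsDedekindDomain.HeightOneSpectrum (NumberField.RingOfIntegers K))), S'.Finite → ∃ T : Set (IsDedekindDomain.HeightOneSpectrum (NumberField.RingOfIntegers K)), T.Finite ∧ Disjoint T S' ∧ (∀ (H : Type) [Group H] [Finite H], Nat.card H ≤ B → ∀ φ : Field.absoluteGaloisGroup K →* H, IsOpen (φ.ker : Set (Field.absoluteGaloisGroup K)) → (∀ v : IsDedekindDomain.HeightOneSpectrum (NumberField.RingOfIntegers K), v ∉ S' → ∀ 𝔓 ∈ v.primesAbove, ∀ σ ∈ 𝔓.inertia (Field.absoluteGaloisGroup K), φ σ = 1) → ∀ g :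 Field.absoluteGaloisGroup K, ∃ v ∈ T, ∃ 𝔓 ∈ v.primesAbove, ∃ σ : Field.absoluteGaloisGroup K, IsArithFrobAt (NumberField.RingOfIntegers K) σ 𝔓 ∧ IsConj (φ σ) (φ g)) ∧ ∀ v ∈ T, SatakeFrobCompatibleAt ι π ρ v) :=
  ⟨certified_of_aeCompatible hCheb ι π ρ, aeCompatible_of_certified hFS ι π ρ hunr havatar⟩

/-! ## Kernel: the split beneath -/

/-- DECIDING THEOREM of the node: FS, CERT and AVC give PRIM BY NAME (every binder used; CHEB not needed in this direction). -/
theorem prim_of_cells (hFS : FaltingsSerreCriterion) (hC : CertifiedMatching) (hA : CertificateAvatars) :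
    PrimitiveTypeAutomorphy := by
  intro K _ _ n hcpt hn ℓ _ ι ρ hirr hgeom hLie hnpsat
  obtain ⟨π, hLalg, hcert⟩ := hC K n hcpt hn ℓ ι ρ hirr hgeom hLie hnpsat
  obtain ⟨ρπ, hρπ⟩ := hA K n hcpt hn ℓ ι π hLalg ⟨ρ, hirr, hgeom, hLie, hnpsat, hcert⟩
  exact ⟨π, hLalg, aeCompatible_of_certified hFS ι π.1 ρ hgeom.1 ⟨ρπ, hρπ⟩ hcert⟩

/-! ## Exactness: PRIM ⟺ CERT modulo the residual; AVC ⇐ W⁺ by name (root-necessity kernels are kit-only) -/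

/-- PRIM ⟹ CERT (mod CHEB): a weakly automorphic ρ is certified by its own π. -/
theorem cert_of_prim (hCheb : ChebotarevCoveringSets) (hP : PrimitiveTypeAutomorphy) : CertifiedMatching := by
  intro K _ _ n hcpt hn ℓ _ ι ρ hirr hgeom hLie hnpsat
  obtain ⟨π, hL, hae⟩ := hP K n hcpt hn ℓ ι ρ hirr hgeom hLie hnpsat
  exact ⟨π, hL, certified_of_aeCompatible hCheb ι π.1 ρ hae⟩

/-- PRIM ⟺ CERT modulo FS, CHEB and the residual AVC: the node's exactness statement at item level. -/
theorem target_iff_cert (hFS : FaltingsSerreCriterion) (hCheb : ChebotarevCoveringSets) (hA : CertificateAvatars) :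
    PrimitiveTypeAutomorphy ↔ CertifiedMatching :=
  ⟨cert_of_prim hCheb, fun hC => prim_of_cells hFS hC hA⟩

/-- AVC is a sub-box of W⁺ (host item `SatakeAvatarExistence` = stmt-Langlands-17415 verbatim): domination BY NAME. -/
theorem avc_of_satakeAvatarExistence (hW : SatakeAvatarExistence) : CertificateAvatars := by
  intro K _ _ n hcpt hn ℓ _ ι π hLalg _
  obtain ⟨ρ, -, hae⟩ := hW K n hcpt (by omega) π hLalg ℓ ι
  exact ⟨ρ, hae⟩

/-- Chain to the summit constant through the PROVED split glue of GEN 29559 and the host's deciding theorem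
`DescentTypeTrichotomy.closes` (host items by name: RankOneAutomorphy, SolvableTypeAutomorphy, InsolvableBaseChangeAutomorphy (DESC),
ArtinTypeAutomorphy, CliffordTateStructure, StructuredTransport, SatakeAvatarExistence, PadicMemberCompatibility,
CompatibilityAwayFromLR, CanonicalReciprocityData). -/
theorem host_of_cells (hFS : FaltingsSerreCriterion) (hC : CertifiedMatching) (hA : CertificateAvatars)
    (hDESC : InsolvableBaseChangeAutomorphy) (h1 : RankOneAutomorphy) (hSAT : SolvableTypeAutomorphy)
    (hS : ArtinTypeAutomorphy) (hT : CliffordTateStructure) (hX : StructuredTransport) (hW : SatakeAvatarExistence)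
    (hP : PadicMemberCompatibility) (hALR : CompatibilityAwayFromLR) (hR : CanonicalReciprocityData) : _root_.Langlands :=
  Summit.Langlands.Langlands.Theses.DescentTypeTrichotomy.closes h1 hSAT
    (Summit.Langlands.Langlands.Theorems.InsolvableTypeAutomorphy_of_split_proof hDESC (prim_of_cells hFS hC hA))
    hS hT hX hW hP hALR hR

end Summit.Langlands.Langlands.Theorems.FSTransfer
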